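import Literature.Probability.RandomPlanarGeometry.SLEKappaRhoControls
import Literature.Probability.RandomPlanarGeometry.SLEKappaRhoFlow
import Literature.Probability.RandomPlanarGeometry.SLERestrictionIncrement
import Literature.Probability.RandomPlanarGeometry.LocalMartingale
import Literature.Probability.Process.ProgressiveClock
import Literature.Probability.Process.ContinuousHitting
import HarnessLib

/-!
# The everywhere-continuous SLE(8/3, ρ) driver with truncated clock, and locality of the controls

G. F. Lawler, O. Schramm, W. Werner, *Conformal restriction: the chordal case*, J. Amer. Math.
Soc. **16** (2003) 917–955 (**[LSW]**), §8.3–8.4. The driving function of SLE(κ, ρ) is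
`W_t = √κ B_t + ρ ∫₀ᵗ du/Z_u`; for the localisation of the local martingale of Lemma 8.9 along
HITTING TIMES we need driving paths that are continuous for EVERY sample (so that hitting times of
closed sets by the continuous adapted controls are stopping times of the raw Brownian filtration).
This file sets up, on the canonical space:

* `SLEKappaRho.drvC J ρ c` — **the driver `√(8/3) B + ρ I^c`** with the truncated
  everywhere-continuous clock `I^c = clockTrunc J c` of `ProgressiveClock` (`J = 1/Z` the
  progressive integrand of a regular version, `SLEKappaRhoRegular`): continuous paths for every
  `ω` (`continuous_drvPath`), `= 0` at time `0`, adapted (`measurable_drvC_of_le`);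
* **locality in the truncation level** (`drvC_eq_of_clock_le`): while the clock is `≤ c ≤ c'`,
  the drivers of levels `c` and `c'` agree — so that the localising times built from level-`k`
  objects increase with `k`;
* **locality of the hull controls in the driver** (`aliveFn_congr`, `clearCtl_congr`,
  `derivCtl_congr`): the controls of `SLEKappaRhoControls` at time `t` only depend on the driving
  path on `[0, t]` (locality of the Loewner flow, `Loewner.map_eq_of_eqOn`,
  `closedHull_eq_of_eqOn`, `slidHull_eq_of_eqOn`);
* `le_of_coe_le_hittingAfter` — **closed controls**: a continuous real process started `≥ ℓ` is
  `≥ ℓ` up to AND INCLUDING its hitting time of `(−∞, ℓ]`; `coe_lt_hittingAfter_of_forall_lt` —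
  it has not hit by time `t` if it is `> ℓ` on `[0, t]`.

No named facts.
-/

noncomputable section

open Set Filter Metric Function MeasureTheory
open _root_.Complex _root_.Topology
open scoped NNReal ENNReal
open Literature.Probability.Process

namespace Literature.Probability.RandomPlanarGeometry

/-! ### Closed controls along continuous paths -/

section ClosedControl

variable {Ω : Type*} {X : ℝ≥0 → Ω → ℝ} {ω : Ω}

/-- **Closed control**: if `t ↦ X_t(ω)` is continuous with `ℓ ≤ X_0(ω)`, then `ℓ ≤ X_t(ω)` at every
time `t ≤` the hitting time of `(−∞, ℓ]` (strictly before it the path is `> ℓ`; at a positive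
hitting time by left-continuity; at the hitting time `0` by the hypothesis). [folklore] -/
theorem le_of_coe_le_hittingAfter (hc : Continuous fun t ↦ X t ω) {ℓ : ℝ} (h0 : ℓ ≤ X 0 ω) {t : ℝ≥0}
    (ht : (t : WithTop ℝ≥0) ≤ hittingAfter X (Iic ℓ) 0 ω) : ℓ ≤ X t ω := by
  rcases ht.lt_or_eq with hlt | heq
  · exact (not_le.1 (notMem_of_coe_lt_hittingAfter_zero (u := X) (s := Iic ℓ) (t := t) hlt)).le
  · -- `t` is the hitting time
    rcases eq_or_ne t 0 with rfl | ht0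
    · exact h0
    · -- left-continuity: `X_s > ℓ` for `s < t`
      have hlt : ∀ s : ℝ≥0, s < t → ℓ < X s ω := fun s hs ↦
        not_le.1 (notMem_of_coe_lt_hittingAfter_zero (u := X) (s := Iic ℓ) (t := s) (by rw [← heq]; exact_mod_cast hs))
      have hmem : X t ω ∈ closure (Ioi ℓ) := by
        have htend : Tendsto (fun s : ℝ≥0 ↦ X s ω) (𝓝[<] t) (𝓝 (X t ω)) := hc.continuousAt.continuousWithinAt.tendsto
        haveI : (𝓝[<] t).NeBot := nhdsLT_neBot_of_exists_lt ⟨0, pos_iff_ne_zero.2 ht0⟩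
        exact mem_closure_of_tendsto htend (eventually_nhdsWithin_of_forall fun s hs ↦ hlt s hs)
      rw [closure_Ioi] at hmem
      exact hmem

/-- A continuous path which is `> ℓ` on `[0, t]` has not hit `(−∞, ℓ]` by time `t`. [folklore] -/
theorem coe_lt_hittingAfter_of_forall_lt (hc : Continuous fun t ↦ X t ω) {ℓ : ℝ} {t : ℝ≥0}
    (h : ∀ s, s ≤ t → ℓ < X s ω) : (t : WithTop ℝ≥0) < hittingAfter X (Iic ℓ) 0 ω := by
  by_contra hle
  push Not at hle
  obtain ⟨j, hj, hjmem⟩ := (hittingAfter_zero_le_coe_iff isClosed_Iic hc).1 hle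
  exact absurd (h j hj) (not_lt.2 hjmem)

/-- The same for the closed set `[ℓ, ∞)`: a continuous path `< ℓ` on `[0, t]` has not hit it.
[folklore] -/
theorem coe_lt_hittingAfter_Ici_of_forall_lt (hc : Continuous fun t ↦ X t ω) {ℓ : ℝ} {t : ℝ≥0}
    (h : ∀ s, s ≤ t → X s ω < ℓ) : (t : WithTop ℝ≥0) < hittingAfter X (Ici ℓ) 0 ω := by
  by_contra hle
  push Not at hle
  obtain ⟨j, hj, hjmem⟩ := (hittingAfter_zero_le_coe_iff isClosed_Ici hc).1 hle
  exact absurd (h j hj) (not_lt.2 hjmem)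

/-- Closed control from above: `X_t ≤ ℓ` up to and including the hitting time of `[ℓ, ∞)` if
`X_0 ≤ ℓ`. [folklore] -/
theorem le_of_coe_le_hittingAfter_Ici (hc : Continuous fun t ↦ X t ω) {ℓ : ℝ} (h0 : X 0 ω ≤ ℓ) {t : ℝ≥0}
    (ht : (t : WithTop ℝ≥0) ≤ hittingAfter X (Ici ℓ) 0 ω) : X t ω ≤ ℓ := by
  rcases ht.lt_or_eq with hlt | heq
  · exact (not_le.1 (notMem_of_coe_lt_hittingAfter_zero (u := X) (s := Ici ℓ) (t := t) hlt)).le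
  · rcases eq_or_ne t 0 with rfl | ht0
    · exact h0
    · have hlt : ∀ s : ℝ≥0, s < t → X s ω < ℓ := fun s hs ↦
        not_le.1 (notMem_of_coe_lt_hittingAfter_zero (u := X) (s := Ici ℓ) (t := s) (by rw [← heq]; exact_mod_cast hs))
      have hmem : X t ω ∈ closure (Iio ℓ) := by
        have htend : Tendsto (fun s : ℝ≥0 ↦ X s ω) (𝓝[<] t) (𝓝 (X t ω)) := hc.continuousAt.continuousWithinAt.tendsto
        haveI : (𝓝[<] t).NeBot := nhdsLT_neBot_of_exists_lt ⟨0, pos_iff_ne_zero.2 ht0⟩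
        exact mem_closure_of_tendsto htend (eventually_nhdsWithin_of_forall fun s hs ↦ hlt s hs)
      rw [closure_Iio] at hmem
      exact hmem

end ClosedControl

namespace SLEKappaRho

variable {J : ℝ≥0 → (ℝ≥0 → ℝ) → ℝ} {ρ : ℝ} {c c' : ℝ≥0}

/-! ### The driver with truncated clock -/

/-- **The SLE(8/3, ρ) driver with clock truncated at level `c`**: `√(8/3) B_t + ρ I^c_t`,
`I^c = clockTrunc J c`. [cite: LawlerSchrammWerner2003Restriction, §8.3 (W_t = √κ B_t + ρ ∫₀ᵗ du/Z_u)] -/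
def drvC (J : ℝ≥0 → (ℝ≥0 → ℝ) → ℝ) (ρ : ℝ) (c : ℝ≥0) (t : ℝ≥0) (ω : ℝ≥0 → ℝ) : ℝ :=
  Real.sqrt (8 / 3) * brownian t ω + ρ * clockTrunc J c t ω

/-- The driving path of a sample. [folklore] -/
def drvPath (J : ℝ≥0 → (ℝ≥0 → ℝ) → ℝ) (ρ : ℝ) (c : ℝ≥0) (ω : ℝ≥0 → ℝ) : ℝ≥0 → ℝ := fun s ↦ drvC J ρ c s ω

/-- Unfolding of `drvPath`. [folklore] -/
@[simp] theorem drvPath_apply (ω : ℝ≥0 → ℝ) (s : ℝ≥0) : drvPath J ρ c ω s = drvC J ρ c s ω := rfl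

/-- **Every driving path is continuous.** [folklore] -/
theorem continuous_drvPath (ω : ℝ≥0 → ℝ) : Continuous (drvPath J ρ c ω) :=
  (continuous_const.mul (continuous_brownian ω)).add (continuous_const.mul (continuous_clockTrunc c ω))

/-- The driver starts at `0`. [folklore] -/
@[simp] theorem drvC_zero (ω : ℝ≥0 → ℝ) : drvC J ρ c 0 ω = 0 := by
  simp [drvC, Process.brownian_zero]

/-- The driving path starts at `0`. [folklore] -/
theorem drvPath_zero (ω : ℝ≥0 → ℝ) : drvPath J ρ c ω 0 = 0 := drvC_zero ω

/-- **The driver is adapted**: `drvC s` is `𝓕_t`-measurable for `s ≤ t` (`J` progressive). [folklore] -/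
theorem measurable_drvC_of_le (hJ : IsStronglyProgressive brownianFiltration J) {s t : ℝ≥0} (hs : s ≤ t) :
    Measurable[brownianFiltration t] (drvC J ρ c s) := by
  have h1 : Measurable[brownianFiltration t] (brownian s) := (adapted_brownian s).mono (brownianFiltration.mono hs) le_rfl
  have h2 : Measurable[brownianFiltration t] (clockTrunc J c s) := (adapted_clockTrunc hJ c s).mono (brownianFiltration.mono hs) le_rfl
  exact (measurable_const.mul h1).add (measurable_const.mul h2)

/-- The driver is adapted. [folklore] -/
theorem adapted_drvC (hJ : IsStronglyProgressive brownianFiltration J) : Adapted brownianFiltration (drvC J ρ c) :=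
  fun _ ↦ measurable_drvC_of_le hJ le_rfl

/-- The driver at each time is measurable. [folklore] -/
theorem measurable_drvC (hJ : IsStronglyProgressive brownianFiltration J) (t : ℝ≥0) : Measurable (drvC J ρ c t) :=
  (adapted_drvC hJ t).mono (brownianFiltration.le t) le_rfl

/-! ### Locality in the truncation level -/

/-- If the truncated clock of level `c` is `≤ k < c` then the clock itself is `≤ k`. [folklore] -/
theorem clock_le_of_clockTrunc_le {k : ℝ≥0} (hkc : k < c) {t : ℝ≥0} {ω : ℝ≥0 → ℝ}
    (h : clockTrunc J c t ω ≤ k) : clock J t ω ≤ (k : ℝ≥0∞) := by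
  rw [clockTrunc] at h
  by_contra hlt
  push Not at hlt
  have hkc' : (k : ℝ≥0∞) < (c : ℝ≥0∞) := by exact_mod_cast hkc
  have hmin : (k : ℝ≥0∞) < min (clock J t ω) (c : ℝ≥0∞) := lt_min hlt hkc'
  have hne : min (clock J t ω) (c : ℝ≥0∞) ≠ ⊤ := ne_top_of_le_ne_top ENNReal.coe_ne_top (min_le_right _ _)
  have := (ENNReal.toReal_lt_toReal ENNReal.coe_ne_top hne).2 hmin
  rw [ENNReal.coe_toReal] at this
  linarith

/-- **Locality in the level**: while the clock is `≤ c ≤ c'`, the two drivers agree on `[0, t]`.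
[folklore] -/
theorem drvC_eq_of_clock_le {t : ℝ≥0} {ω : ℝ≥0 → ℝ} (ht : clock J t ω ≤ (c : ℝ≥0∞)) (hcc' : c ≤ c')
    {s : ℝ≥0} (hs : s ≤ t) : drvC J ρ c s ω = drvC J ρ c' s ω := by
  have hsclock : clock J s ω ≤ c := (monotone_clock J ω hs).trans ht
  rw [drvC, drvC, clockTrunc_eq_clockTrunc hsclock hcc']

/-- The truncated clocks agree too. [folklore] -/
theorem clockTrunc_eq_of_clock_le {t : ℝ≥0} {ω : ℝ≥0 → ℝ} (ht : clock J t ω ≤ (c : ℝ≥0∞)) (hcc' : c ≤ c')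
    {s : ℝ≥0} (hs : s ≤ t) : clockTrunc J c s ω = clockTrunc J c' s ω :=
  clockTrunc_eq_clockTrunc ((monotone_clock J ω hs).trans ht) hcc'

/-! ### The relative position of the force point -/

/-- **`o = O − W = −(W + 2I)` clipped at `0`** (it is `≤ 0` on the good paths; the clipping makes
it so everywhere). [cite: LawlerSchrammWerner2003Restriction, §8.3 (O_t ≤ W_t)] -/
def oposC (J : ℝ≥0 → (ℝ≥0 → ℝ) → ℝ) (ρ : ℝ) (c : ℝ≥0) (t : ℝ≥0) (ω : ℝ≥0 → ℝ) : ℝ :=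
  min (-(drvC J ρ c t ω + 2 * clockTrunc J c t ω)) 0

/-- `o ≤ 0`. [folklore] -/
theorem oposC_nonpos (t : ℝ≥0) (ω : ℝ≥0 → ℝ) : oposC J ρ c t ω ≤ 0 := min_le_right _ _

/-- `|o| ≤ |W| + 2 I`. [folklore] -/
theorem abs_oposC_le (t : ℝ≥0) (ω : ℝ≥0 → ℝ) : |oposC J ρ c t ω| ≤ |drvC J ρ c t ω| + 2 * clockTrunc J c t ω := by
  have hI := (clockTrunc_mem_Icc (J := J) c t ω).1
  rw [oposC]
  rcases le_or_gt (-(drvC J ρ c t ω + 2 * clockTrunc J c t ω)) 0 with h | h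
  · rw [min_eq_left h, abs_of_nonpos h, neg_neg]
    linarith [le_abs_self (drvC J ρ c t ω)]
  · rw [min_eq_right h.le, abs_zero]; positivity

/-- `o` is adapted. [folklore] -/
theorem measurable_oposC_of_le (hJ : IsStronglyProgressive brownianFiltration J) {s t : ℝ≥0} (hs : s ≤ t) :
    Measurable[brownianFiltration t] (oposC J ρ c s) := by
  have h2 : Measurable[brownianFiltration t] (clockTrunc J c s) := (adapted_clockTrunc hJ c s).mono (brownianFiltration.mono hs) le_rfl
  exact ((measurable_drvC_of_le hJ hs).add (measurable_const.mul h2)).neg.min measurable_const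

/-- `o` is continuous in time. [folklore] -/
theorem continuous_oposC (ω : ℝ≥0 → ℝ) : Continuous fun t ↦ oposC J ρ c t ω :=
  ((continuous_drvPath ω).add (continuous_const.mul (continuous_clockTrunc c ω))).neg.min continuous_const

/-- Locality of `o` in the level. [folklore] -/
theorem oposC_eq_of_clock_le {t : ℝ≥0} {ω : ℝ≥0 → ℝ} (ht : clock J t ω ≤ (c : ℝ≥0∞)) (hcc' : c ≤ c')
    {s : ℝ≥0} (hs : s ≤ t) : oposC J ρ c s ω = oposC J ρ c' s ω := by
  rw [oposC, oposC, drvC_eq_of_clock_le ht hcc' hs, clockTrunc_eq_of_clock_le ht hcc' hs]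

end SLEKappaRho

/-! ### Locality of the hull controls in the driving path -/

namespace Loewner

variable {Ω : Type*} {W U : Ω → ℝ≥0 → ℝ} {A K : Set ℂ} {t : ℝ≥0} {a : ℕ → ℂ} {ω : Ω}

/-- The clipped distances only depend on the path up to their time. [folklore] -/
theorem clipDist_congr (hW : Continuous (W ω)) (hU : Continuous (U ω)) {q : ℝ≥0}
    (heq : ∀ s, s ≤ q → W ω s = U ω s) (k : ℕ) : clipDist a W k q ω = clipDist a U k q ω := by
  unfold clipDist
  by_cases h : (q : WithTop ℝ≥0) < swallowingTime (W ω) (a k)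
  · have h' : (q : WithTop ℝ≥0) < swallowingTime (U ω) (a k) := coe_lt_swallowingTime_of_eqOn hW hU heq h
    rw [if_pos h, if_pos h', map_eq_of_eqOn hW hU heq h le_rfl, heq q le_rfl]
  · have h' : ¬ (q : WithTop ℝ≥0) < swallowingTime (U ω) (a k) := fun h' ↦
      h (coe_lt_swallowingTime_of_eqOn hU hW (fun s hs ↦ (heq s hs).symm) h')
    rw [if_neg h, if_neg h']

/-- **`aliveFn_t` only depends on the path on `[0, t]`.** [folklore] -/
theorem aliveFn_congr (hW : Continuous (W ω)) (hU : Continuous (U ω)) (heq : ∀ s, s ≤ t → W ω s = U ω s) :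
    aliveFn a W t ω = aliveFn a U t ω := by
  unfold aliveFn
  congr 1
  · refine iInf_congr fun p ↦ ?_
    exact clipDist_congr hW hU (fun s hs ↦ heq s (hs.trans (ratTimes.val_le p.2))) p.1
  · exact iInf_congr fun k ↦ clipDist_congr hW hU heq k

/-- The alive events agree. [folklore] -/
theorem disjoint_closedHull_congr (hW : Continuous (W ω)) (hU : Continuous (U ω)) (heq : ∀ s, s ≤ t → W ω s = U ω s) :
    Disjoint (closedHull (W ω) t) A ↔ Disjoint (closedHull (U ω) t) A := by
  rw [closedHull_eq_of_eqOn hW hU heq]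

/-- At an alive time the slid points agree. [folklore] -/
theorem slidPt_congr (hW : Continuous (W ω)) (hU : Continuous (U ω)) (heq : ∀ s, s ≤ t → W ω s = U ω s)
    (hA : IsStarHull A) (ha : ∀ k, a k ∈ A) (halive : Disjoint (closedHull (W ω) t) A) (k : ℕ) :
    slidPt W a t k ω = slidPt U a t k ω := by
  unfold slidPt
  rw [map_eq_of_eqOn hW hU heq (lt_swallowingTime_of_alive hA halive (ha k)) le_rfl, heq t le_rfl]

/-- **`clearCtl_t` only depends on the path on `[0, t]`** (`c ≥ 0`; at dead times both vanish).
[folklore] -/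
theorem clearCtl_congr (hW : Continuous (W ω)) (hU : Continuous (U ω)) (hW0 : W ω 0 = 0) (heq : ∀ s, s ≤ t → W ω s = U ω s)
    (hA : IsStarHull A) (ha : ∀ k, a k ∈ A ∧ 0 < (a k).im) (hdense : A ⊆ closure (range a)) (c : ℝ) :
    clearCtl c K a W t ω = clearCtl c K a U t ω := by
  have hR := aliveFn_congr (a := a) hW hU heq
  by_cases halive : Disjoint (closedHull (W ω) t) A
  · unfold clearCtl clearFn
    rw [hR]
    congr 1
    exact iInf_congr fun k ↦ by rw [slidPt_congr hW hU heq hA (fun k ↦ (ha k).1) halive k]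
  · -- dead for both: `aliveFn = 0`
    have hU0 : U ω 0 = 0 := by rw [← heq 0 bot_le]; exact hW0
    have halive' : ¬ Disjoint (closedHull (U ω) t) A := by rwa [← disjoint_closedHull_congr hW hU heq]
    have h1 : aliveFn a W t ω = 0 := aliveFn_eq_zero_of_not_disjoint hW hW0 hA hdense (fun k ↦ (ha k).2) halive
    have h2 : aliveFn a U t ω = 0 := aliveFn_eq_zero_of_not_disjoint hU hU0 hA hdense (fun k ↦ (ha k).2) halive'
    unfold clearCtl
    rw [h1, h2, mul_zero, min_eq_right (clearFn_nonneg K a W t ω), min_eq_right (clearFn_nonneg K a U t ω)]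

/-- **`derivCtl_t` only depends on the path on `[0, t]`.** [folklore] -/
theorem derivCtl_congr (hW : Continuous (W ω)) (hU : Continuous (U ω)) (heq : ∀ s, s ≤ t → W ω s = U ω s)
    (hA : IsStarHull A) (c : ℝ) : derivCtl c A a W t ω = derivCtl c A a U t ω := by
  unfold derivCtl
  rw [aliveFn_congr (a := a) hW hU heq]
  congr 1
  by_cases halive : Disjoint (closedHull (W ω) t) A
  · have halive' : Disjoint (closedHull (U ω) t) A := (disjoint_closedHull_congr hW hU heq).1 halive
    rw [Set.indicator_of_mem (show ω ∈ {ω | Disjoint (closedHull (W ω) t) A} from halive),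
      Set.indicator_of_mem (show ω ∈ {ω | Disjoint (closedHull (U ω) t) A} from halive'),
      slidHull_eq_of_eqOn hW hU heq fun _ hz ↦ lt_swallowingTime_of_alive hA halive hz]
  · have halive' : ¬ Disjoint (closedHull (U ω) t) A := by rwa [← disjoint_closedHull_congr hW hU heq]
    rw [Set.indicator_of_notMem (show ω ∉ {ω | Disjoint (closedHull (W ω) t) A} from halive),
      Set.indicator_of_notMem (show ω ∉ {ω | Disjoint (closedHull (U ω) t) A} from halive')]

/-- The slid hulls agree at an alive time. [folklore] -/
theorem slidHull_congr (hW : Continuous (W ω)) (hU : Continuous (U ω)) (heq : ∀ s, s ≤ t → W ω s = U ω s)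
    (hA : IsStarHull A) (halive : Disjoint (closedHull (W ω) t) A) : slidHull (U ω) A t = slidHull (W ω) A t :=
  slidHull_eq_of_eqOn hW hU heq fun _ hz ↦ lt_swallowingTime_of_alive hA halive hz

end Loewner

end Literature.Probability.RandomPlanarGeometry

end
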